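import Summits.FinalStateConjecture.FinalStateConjecture.Theorems.EIHFluxBalanceInertialRecessionLorentz
import Summits.FinalStateConjecture.FinalStateConjecture.Theorems.EIHFluxBalanceInertialRecessionSlavingFarFieldBoost
import Summits.FinalStateConjecture.FinalStateConjecture.Theorems.EIHFluxBalanceInertialRecessionSlavingFarFieldSpeed
import Literature.Geometry.Lorentzian.KerrEnergyIdentity
import Mathlib.Analysis.InnerProductSpace.Projection.Reflection

/-!
# Route EIHFluxBalance — `InertialRecession` (E′), line `SketchCleanExcision`, skeleton r13,
# stub `stub_coerMomKernel` (Bk), part 7: FRAMES — every Lorentz frame operator factors as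
# (rest isometry fixing `e₀`) ∘ boost(v e₁)⁻¹ ∘ (involutive lab isometry preserving the slice)

Helper file for the crux `stmt-FinalStateConjecture-17403`
(`Summit.FinalStateConjecture.FinalStateConjecture.Theses.EIHFluxBalance.InertialRecession`, E′),
registered stub `stub_coerMomKernel` (Bk) of skeleton r13 (seat 1).

* `bk_exists_householder` — for `a ∈ E3` there is an involutive linear isometry `Q` of `E3` with
  `Q a = ‖a‖ e₁` (a Householder reflection, `Submodule.reflection_sub`, or the identity);
* **`bk_frame_decomposition`** — for every `Λ ∈ O(1,3)` there are `s ∈ [0, 1)`, an involutive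
  `η`-isometry `N` with `N e₀ = ±e₀`, and an `η`-isometry `R` with `R e₀ = e₀` and two-sided
  inverse `R⁻¹`, such that `Λ⁻¹ = R ∘ boost((2s/(1+s²)) e₁)⁻¹ ∘ N`: with `u = Λe₀`,
  `N = (sign u⁰) ⊕ Q` for the Householder `Q` sending `u⃗` to `‖u⃗‖e₁` (so `N u = boost e₀`, the
  lab velocity being `‖u⃗‖/|u⁰| = 2s/(1+s²)`, `exists_halfAngle_of_speed`), and
  `R = Λ⁻¹ ∘ N ∘ boost`.

No definitions, no named facts, no `sorry`.
-/

set_option linter.dupNamespace false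
set_option maxSynthPendingDepth 3

noncomputable section

open Set Function Filter ContinuousLinearMap Literature.Geometry.Lorentzian
open scoped Topology InnerProductSpace

namespace Summit.FinalStateConjecture.FinalStateConjecture.Theorems.SublinearIsFree.Slaving

/-- **Householder**: an involutive linear isometry of `E3` sending `a` to `‖a‖ e₁`. [folklore] -/
theorem bk_exists_householder (a : E3) :
    ∃ Q : E3 ≃ₗᵢ[ℝ] E3, (∀ p : E3, Q (Q p) = p) ∧ Q a = ‖a‖ • (EuclideanSpace.single 0 1 : E3) := by
  by_cases h : a = ‖a‖ • (EuclideanSpace.single 0 1 : E3)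
  · exact ⟨LinearIsometryEquiv.refl ℝ E3, fun p ↦ rfl, h⟩
  · have hn : ‖a‖ = ‖‖a‖ • (EuclideanSpace.single 0 1 : E3)‖ := by
      rw [norm_smul, PiLp.norm_single, norm_one, mul_one, Real.norm_eq_abs, abs_norm]
    refine ⟨(Submodule.span ℝ {a - ‖a‖ • (EuclideanSpace.single 0 1 : E3)})ᗮ.reflection,
      fun p ↦ Submodule.reflection_reflection _ p, ?_⟩
    exact Submodule.reflection_sub hn

set_option maxHeartbeats 1600000 in
/-- **Frame decomposition.** For every `Λ ∈ O(1,3)` there are `0 ≤ s < 1`, an involutive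
`η`-isometry `N` of `E4` with `N e₀ = ±e₀`, an `η`-isometry `R` with `R e₀ = e₀` and a two-sided
inverse `R⁻¹`, such that `Λ⁻¹ v = R (boost((2s/(1+s²)) e₁)⁻¹ (N v))` for all `v`. [folklore] -/
theorem bk_frame_decomposition (L : lorentzGroup) :
    ∃ (s : ℝ) (hw : ‖((2 * s / (1 + s ^ 2)) • (EuclideanSpace.single 0 1 : E3))‖ < 1)
      (N Rr Rinv : E4 →L[ℝ] E4), 0 ≤ s ∧ s < 1 ∧
      (∀ u w : E4, Minkowski.bilin (N u) (N w) = Minkowski.bilin u w) ∧ (∀ w : E4, N (N w) = w) ∧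
      (N (E4.basisVector 0) = E4.basisVector 0 ∨ N (E4.basisVector 0) = -E4.basisVector 0) ∧
      (∀ u w : E4, Minkowski.bilin (Rr u) (Rr w) = Minkowski.bilin u w) ∧ Rr (E4.basisVector 0) = E4.basisVector 0 ∧
      (∀ w : E4, Rr (Rinv w) = w) ∧ (∀ w : E4, Rinv (Rr w) = w) ∧
      ∀ v : E4, ((L : E4 ≃L[ℝ] E4).symm : E4 →L[ℝ] E4) v =
        Rr ((((Lorentz.boost ((2 * s / (1 + s ^ 2)) • (EuclideanSpace.single 0 1 : E3)) hw : E4 ≃L[ℝ] E4).symm : E4 →L[ℝ] E4)) (N v)) := by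
  -- the painted 4-velocity
  set u : E4 := (L : E4 ≃L[ℝ] E4) (E4.basisVector 0) with hu
  have hsq : u 0 ^ 2 = 1 + E4.spatialNorm u ^ 2 := lorentz_apply_zero_sq L
  have hu0 : u 0 ≠ 0 := fun h ↦ by
    rw [h] at hsq; nlinarith [sq_nonneg (E4.spatialNorm u)]
  have habs : 0 < |u 0| := abs_pos.2 hu0
  -- the lab speed and its half-angle parameter
  set vv : ℝ := E4.spatialNorm u / |u 0| with hvv
  have hvv0 : 0 ≤ vv := div_nonneg (E4.spatialNorm_nonneg u) habs.le
  have hvv1 : vv < 1 := by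
    rw [hvv, div_lt_one habs]
    have h1 : E4.spatialNorm u ^ 2 < |u 0| ^ 2 := by rw [sq_abs]; linarith
    exact lt_of_pow_lt_pow_left₀ 2 (abs_nonneg _) h1
  obtain ⟨s, hs0, hs1, hvs⟩ := exists_halfAngle_of_speed hvv0 hvv1
  have hsabs : |s| < 1 := abs_lt.2 ⟨by linarith, hs1⟩
  have hw := norm_vel_lt_one hsabs
  -- Householder on the spatial part of `u`
  obtain ⟨Q, hQQ, hQu⟩ := bk_exists_householder (E4.spatial u)
  -- the sign of `u⁰`
  set σ : ℝ := if 0 < u 0 then 1 else -1 with hσ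
  have hσ2 : σ * σ = 1 := by rw [hσ]; split_ifs <;> norm_num
  have hσu : σ * u 0 = |u 0| := by
    rw [hσ]; split_ifs with h
    · rw [one_mul, abs_of_pos h]
    · rw [abs_of_neg (lt_of_le_of_ne (not_lt.1 h) hu0)]; ring
  -- the lab map `N w = (σ w⁰) e₀ + (0, Q w⃗)`
  set N : E4 →L[ℝ] E4 := (σ • (EuclideanSpace.proj (0 : Fin 4) : E4 →L[ℝ] ℝ)).smulRight (E4.basisVector 0)
      + E4.spaceEmbed.comp ((Q.toContinuousLinearEquiv : E3 →L[ℝ] E3).comp E4.spatial) with hN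
  have hN_apply : ∀ w : E4, N w = (σ * w 0) • E4.basisVector 0 + E4.ofTimeSpace 0 (Q (E4.spatial w)) := by
    intro w
    simp [hN, E4.spaceEmbed_apply]
  have hN0 : ∀ w : E4, N w 0 = σ * w 0 := fun w ↦ by
    rw [hN_apply]; simp
  have hNsp : ∀ w : E4, E4.spatial (N w) = Q (E4.spatial w) := fun w ↦ by
    rw [hN_apply, map_add, map_smul, E4.spatial_ofTimeSpace]
    have : E4.spatial (E4.basisVector 0) = 0 := by ext i; simp
    rw [this, smul_zero, zero_add]
  have hNN : ∀ w : E4, N (N w) = w := by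
    intro w
    ext i
    refine Fin.cases ?_ (fun j ↦ ?_) i
    · rw [hN0, hN0, ← mul_assoc, hσ2, one_mul]
    · rw [← E4.spatial_apply (N (N w)) j, hNsp, hNsp, hQQ, E4.spatial_apply]
  have hNiso : ∀ a b : E4, Minkowski.bilin (N a) (N b) = Minkowski.bilin a b := by
    intro a b
    rw [Lorentz.minkowski_bilin_eq_inner, Lorentz.minkowski_bilin_eq_inner, hN0, hN0, hNsp, hNsp,
      Q.inner_map_map]
    have : σ * a 0 * (σ * b 0) = (σ * σ) * (a 0 * b 0) := by ring
    rw [this, hσ2, one_mul]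
  have hNe0 : N (E4.basisVector 0) = E4.basisVector 0 ∨ N (E4.basisVector 0) = -E4.basisVector 0 := by
    have h0 : E4.spatial (E4.basisVector 0) = 0 := by ext i; simp
    have h1 : N (E4.basisVector 0) = σ • E4.basisVector 0 := by
      rw [hN_apply, h0, map_zero]
      have : E4.ofTimeSpace 0 (0 : E3) = 0 := by
        ext i; refine Fin.cases ?_ (fun j ↦ ?_) i <;> simp
      rw [this, add_zero]
      simp
    rw [h1, hσ]
    split_ifs
    · left; rw [one_smul]
    · right; rw [neg_one_smul]
  -- the boost and its inverse
  set B : E4 →L[ℝ] E4 := Lorentz.boostCLM ((2 * s / (1 + s ^ 2)) • (EuclideanSpace.single 0 1 : E3)) with hB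
  set S₀ : E4 →L[ℝ] E4 := (((Lorentz.boost ((2 * s / (1 + s ^ 2)) • (EuclideanSpace.single 0 1 : E3)) hw : E4 ≃L[ℝ] E4).symm : E4 →L[ℝ] E4)) with hS₀
  have hBS : ∀ w : E4, B (S₀ w) = w := fun w ↦ by
    have h := (Lorentz.boost ((2 * s / (1 + s ^ 2)) • (EuclideanSpace.single 0 1 : E3)) hw : E4 ≃L[ℝ] E4).apply_symm_apply w
    rw [Lorentz.coe_boost_apply] at h
    exact h
  have hSB : ∀ w : E4, S₀ (B w) = w := fun w ↦ by
    have h := (Lorentz.boost ((2 * s / (1 + s ^ 2)) • (EuclideanSpace.single 0 1 : E3)) hw : E4 ≃L[ℝ] E4).symm_apply_apply w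
    rw [Lorentz.coe_boost_apply] at h
    exact h
  have hBiso : ∀ a b : E4, Minkowski.bilin (B a) (B b) = Minkowski.bilin a b :=
    Lorentz.minkowski_boostCLM hw
  -- the boost has the 4-velocity `N u`
  have hBe0 : B (E4.basisVector 0) = N u := by
    have h := Lorentz.boost_apply_basisVector_zero hw
    rw [Lorentz.coe_boost_apply] at h
    rw [hB, h, ← E4.ofTimeSpace_time_spatial (N u), E4.time_apply, hN0, hNsp, hQu, hσu]
    -- the Lorentz factor: `γ = |u⁰|`, `γ v = ‖u⃗‖`
    have hγ := gamma_vel hsabs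
    have hγ' : Lorentz.gamma ((2 * s / (1 + s ^ 2)) • (EuclideanSpace.single 0 1 : E3)) = |u 0| := by
      unfold Lorentz.gamma
      rw [norm_vel, sq_abs, ← hvs, hvv, div_pow, sq_abs]
      have h1 : u 0 ^ 2 ≠ 0 := pow_ne_zero 2 hu0
      have h2 : 1 - E4.spatialNorm u ^ 2 / u 0 ^ 2 = (u 0 ^ 2)⁻¹ := by
        field_simp; linarith
      rw [h2, Real.sqrt_inv, Real.sqrt_sq_eq_abs, inv_inv]
    rw [hγ', smul_smul, ← hvs, hvv, mul_div_cancel₀ _ habs.ne']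
    rw [show E4.spatialNorm u = ‖E4.spatial u‖ from rfl]
  -- the rest map and its inverse
  set S : E4 →L[ℝ] E4 := ((L : E4 ≃L[ℝ] E4).symm : E4 →L[ℝ] E4) with hS
  have hSL : ∀ w : E4, S ((L : E4 ≃L[ℝ] E4) w) = w := fun w ↦ (L : E4 ≃L[ℝ] E4).symm_apply_apply w
  have hLS : ∀ w : E4, (L : E4 ≃L[ℝ] E4) (S w) = w := fun w ↦ (L : E4 ≃L[ℝ] E4).apply_symm_apply w
  have hSiso : ∀ a b : E4, Minkowski.bilin (S a) (S b) = Minkowski.bilin a b := by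
    intro a b
    have h := L.2 (S a) (S b)
    rw [hLS, hLS] at h
    exact h.symm
  set Rr : E4 →L[ℝ] E4 := S.comp (N.comp B) with hRr
  set Rinv : E4 →L[ℝ] E4 := S₀.comp (N.comp ((L : E4 ≃L[ℝ] E4) : E4 →L[ℝ] E4)) with hRinv
  refine ⟨s, hw, N, Rr, Rinv, hs0, hs1, hNiso, hNN, hNe0, ?_, ?_, ?_, ?_, ?_⟩
  · intro a b
    show Minkowski.bilin (S (N (B a))) (S (N (B b))) = Minkowski.bilin a b
    rw [hSiso, hNiso, hBiso]
  · show S (N (B (E4.basisVector 0))) = E4.basisVector 0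
    rw [hBe0, hNN, hu, hSL]
  · intro w
    show S (N (B (S₀ (N ((L : E4 ≃L[ℝ] E4) w))))) = w
    rw [hBS, hNN, hSL]
  · intro w
    show S₀ (N ((L : E4 ≃L[ℝ] E4) (S (N (B w))))) = w
    rw [hLS, hNN, hSB]
  · intro v
    show S v = S (N (B (S₀ (N v))))
    rw [hBS, hNN]

/-- **Registered carrier** `bk_frames_carrier` of the crux item (one-line form of a lemma of this file,
for the `--supports` protocol). [folklore] -/
theorem bk_frames_carrier : open Literature.Geometry.Lorentzian in ∀ a : E3, ∃ Q : E3 ≃ₗᵢ[ℝ] E3, (∀ p : E3, Q (Q p) = p) ∧ Q a = ‖a‖ • (EuclideanSpace.single 0 1 : E3) :=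
  bk_exists_householder

end Summit.FinalStateConjecture.FinalStateConjecture.Theorems.SublinearIsFree.Slaving

end
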